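import Literature.Barriers.BirchSwinnertonDyer.RankNotSumOfLocalInvariantsF3
import Literature.Barriers.BirchSwinnertonDyer.RankNotSumOfLocalInvariantsC3C3Proofs
import Literature.Barriers.BirchSwinnertonDyer.RankNotSumOfLocalInvariants480a1Proofs
import HarnessLib

/-!
# Barrier (BirchSwinnertonDyer), rank mod `3`: `rk E(F₃) = 1` reduced to four cubic `2`-descents

Companion to `Literature/Barriers/BirchSwinnertonDyer/RankNotSumOfLocalInvariantsF3.lean`, which
constructs the field `F₃` of T. Dokchitser–V. Dokchitser, *A note on the Mordell–Weil rank modulo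
`n`*, J. Number Theory 131 (2011) 1833–1839 (arXiv:0910.4588), proof of Theorem 2 — "the degree 9
subfield of `ℚ(ζ₁₃, ζ₁₀₃)`" — proves its splitting properties, and reduces the `n = 3` witness of
Theorem 2 (the named fact `Literature.Barriers.BirchSwinnertonDyer.DokchitserDokchitser2011_rank_480a1_F3`
of `RankNotSumOfLocalInvariantsProofs.lean`) to the ONE statement that is a computer calculation in
the source: `rk_ℤ E(F₃) = 1`, i.e. `(curve480a1.baseChange F₃).mordellWeilRank = 1`, for
`E = 480a1 : y² = x(x+2)(x-3)` — "2-descent shows that `rk E/F₃ = 1` (e.g. using Magma, over all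
minimal non-trivial subfields of `F_n`)" (p. 3 of the held arXiv copy).

This file formalises that sentence up to the Magma runs themselves: `Gal(F₃/ℚ) ≅ C₃ × C₃`, the
minimal non-trivial subfields of `F₃` are its four cubic subfields `K = F₃^{⟨σ⟩}` (`σ ≠ 1`), and
`rk E(F₃) = 1` FOLLOWS from the `2`-descent bounds `rk E(K) ≤ 1` over these cubic fields together
with the rational point `(-1, 2)` of infinite order — and conversely, so that the cubic bounds are
EQUIVALENT to `rk E(F₃) = 1` (`DokchitserDokchitser2011_descent_480a1_F3_iff_cubic`).

| source (DokchitserDokchitser2011RankModN, proof of Thm. 2, `n = 3`) | declaration | status |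
|---|---|---|
| `Gal(F₃/ℚ) ≅ C₃ × C₃` (order `9`, exponent `3`) | `F₃.card_aut` (F3 file), `F₃.algEquiv_pow_three` | proved |
| "minimal non-trivial subfields of `F₃`" = the cubic subfields `K_σ = F₃^{⟨σ⟩}`, `σ ≠ 1` | `F₃.cubicField`, `F₃.mem_cubicField_of_apply_eq`, `F₃.finrank_cubicField` (`[K_σ : ℚ] = 3`) | definition + proved |
| `480a1` has a rational point of infinite order (`rk E(ℚ) ≥ 1`) | `curve480a1.exists_nsmul_ne_zero` (`…480a1Proofs.lean`) | proved |
| "2-descent […] over all minimal non-trivial subfields": `rk E(K_σ) ≤ 1` | `DokchitserDokchitser2011_descent_480a1_F3_cubic` | named fact (the only leaf) |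
| Galois descent `C₃ × C₃`: `rk E(F₃) = rk E(ℚ) + ∑_K (rk E(K) - rk E(ℚ)) = 1` | `DokchitserDokchitser2011.mordellWeilRank_baseChange_eq_one_of_exponent_three` (`…C3C3Proofs.lean`), `DokchitserDokchitser2011_descent_480a1_F3_of_cubic` | proved |
| converse `rk E(K_σ) ≤ rk E(F₃)` | `DokchitserDokchitser2011_descent_480a1_F3_cubic_of_descent`, `…_iff_cubic` | proved |
| the `n = 3` case of Thm. 2 from the cubic descents | `DokchitserDokchitser2011_rank_480a1_F3_of_cubic`, `not_isSumOfLocalInvariants_rankInvariant_zmod_three_of_cubic` | proved |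

Bookkeeping (split review 2026-08-15, D-0026). `rk_ℤ E(F₃) = 1` is written out in this file as
the equation `(curve480a1.baseChange F₃).mordellWeilRank = 1` and is NOT a separately named fact:
it is the parent fact `DokchitserDokchitser2011_rank_480a1_F3` specialised at `F := F₃` (same
locator), and the only unproved input below it is the cubic leaf
`DokchitserDokchitser2011_descent_480a1_F3_cubic`, to which it is equivalent.

## The mathematics (as formalised)

`Gal(F₃/ℚ) ≅ Gal(ℚ(ζ₁₃₃₉)/ℚ) / H` with `H = {u : u¹³⁶ = 1} ≤ (ℤ/1339)ˣ` (Mathlib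
`IsGalois.normalAutEquivQuotient`), and `u⁴⁰⁸ = (u²⁰⁴)² = 1` for every `u` (F3 file,
`units_pow_204`), so `σ³ = 1` for all `σ ∈ Gal(F₃/ℚ)`; with `|Gal(F₃/ℚ)| = 9` this is
`C₃ × C₃`, whose proper non-trivial subgroups are the four `⟨σ⟩ ≅ C₃`, `σ ≠ 1`, so the minimal
non-trivial subfields of `F₃` are the fixed fields `K_σ = F₃^{⟨σ⟩}`, of degree `9 / 3 = 3`
(Artin: `[F₃ : K_σ] = |⟨σ⟩| = 3`). (Mathematically these are the cubic subfields of `ℚ(ζ₁₃)`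
and `ℚ(ζ₁₀₃)` and two cyclic cubic fields of conductor `1339`; this identification is not
formalised or used.) Let `M = E(F₃)`, a finitely generated abelian group (Mordell–Weil, tree
theorem `WeierstrassCurve.module_finite_point_holds`) with `Gal(F₃/ℚ)` acting by transport of
coordinates, and `m₀ ∈ M` the image of `P = (-1, 2) ∈ E(ℚ)`, of infinite order
(`curve480a1.exists_nsmul_ne_zero`, a `2`-descent argument). A point fixed by `σ ≠ 1` lies in
`E(K_σ)`, where — granted `rk E(K_σ) ≤ 1` — it is rationally dependent on `m₀`; the identity
`6 = ∑_{σ ≠ 1} (1 + σ + σ²) - 2 ∑_σ σ` in `ℤ[C₃ × C₃]` then makes every `m ∈ M` rationally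
dependent on `m₀`, i.e. `rk_ℤ M = 1` (`…C3C3Proofs.lean`).

## Design notes

* `K_σ` is defined for every `σ` (for `σ = 1` it is `F₃` itself); the named fact quantifies over
  `σ ≠ 1`, i.e. over the four cubic subfields, each counted twice (`K_σ = K_{σ²}`), exactly the
  "minimal non-trivial subfields" of the source. It is stated with
  `WeierstrassCurve.mordellWeilRank` (`= Module.finrank ℤ E(K_σ)`, honest by Mordell–Weil) and as the inequality `≤ 1` that a
  `2`-descent delivers (a `2`-Selmer rank bound); equality then follows (`rk E(ℚ) ≥ 1`).
* `Gal(F₃/ℚ)` is `↥F₃ ≃ₐ[ℚ] ↥F₃` for the canonical `ℚ`-algebra structure `DivisionRing.toRatAlgebra`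
  (as in the F3 file); Mathlib's `IsGalois.normalAutEquivQuotient` produces it for the subalgebra
  structure `IntermediateField.algebra'`, definitionally equal, and `F₃.algEquiv_pow_three` crosses
  over by `exact`.
* What is NOT here: the four `2`-descents themselves (`2`-Selmer groups of `480a1` over cyclic cubic
  fields: `S`-units and class groups of the `K_σ` for `S ∣ 30`, and the local images at the primes
  above `2`, `3`, `5` and at the real places), for which Lean has no infrastructure yet; they are
  the named fact `DokchitserDokchitser2011_descent_480a1_F3_cubic`.

## References

* T. Dokchitser, V. Dokchitser, *A note on the Mordell–Weil rank modulo `n`*, J. Number Theory 131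
  (2011) 1833–1839, arXiv:0910.4588: proof of Thm. 2 (p. 3 of the held arXiv copy): "2-descent
  shows that `rk E/F₃ = rk E/F₅ = 1` and `rk E/F₄ = 6` (e.g. using Magma, over all minimal
  non-trivial subfields of `F_n`)". [DokchitserDokchitser2011RankModN]
* J. Neukirch, *Algebraic Number Theory*, Grundlehren 322 (1999), Ch. IV §1 (Galois theory of
  `ℚ(ζₙ)/ℚ`). [NeukirchANT1999]
-/

noncomputable section

open scoped NumberField

open NumberField WeierstrassCurve IntermediateField

namespace Literature.Barriers.BirchSwinnertonDyer

namespace DokchitserDokchitser2011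

open Cyclotomic1339

namespace F₃

/-- **`Gal(F₃/ℚ)` has exponent `3`** (so, being of order `9`, it is `C₃ × C₃`): every
`σ ∈ Gal(F₃/ℚ) ≅ Gal(ℚ(ζ₁₃₃₉)/ℚ) / H` is the restriction of some `τ`, and `τ³ ∈ H = {u : u¹³⁶ = 1}`
because `u⁴⁰⁸ = (u²⁰⁴)² = 1` in `(ℤ/1339)ˣ ≅ C₁₂ × C₁₀₂`. [folklore] -/
theorem algEquiv_pow_three (σ : Gal(F₃/ℚ)) : σ ^ 3 = 1 := by
  have key : ∀ q : Gal(Cyclotomic1339/ℚ) ⧸ F₃.subgroup, q ^ 3 = 1 := by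
    intro q
    obtain ⟨τ, rfl⟩ := QuotientGroup.mk_surjective q
    rw [← QuotientGroup.mk_pow, QuotientGroup.eq_one_iff, mem_subgroup_iff, map_pow, ← pow_mul,
      show 3 * 136 = 204 * 2 by norm_num, pow_mul, units_pow_204, one_pow]
  -- `Gal(F₃/ℚ) ≅ Gal(ℚ(ζ₁₃₃₉)/ℚ) ⧸ H` (Mathlib `IsGalois.normalAutEquivQuotient`, stated for the
  -- subalgebra `ℚ`-structure on `F₃ = fixedField H`, definitionally the canonical one)
  have key2 : ∀ q, IsGalois.normalAutEquivQuotient F₃.subgroup q ^ 3 = 1 := fun q => by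
    rw [← map_pow, key, map_one]
  obtain ⟨q, hq⟩ := (IsGalois.normalAutEquivQuotient F₃.subgroup).surjective σ
  have h := key2 q
  rw [hq] at h
  exact h

/-- The subfield `K_σ = F₃^{⟨σ⟩}` of `F₃` fixed by `σ ∈ Gal(F₃/ℚ)`. For `σ ≠ 1` these are the four
cubic subfields of `F₃` (`finrank_cubicField`; `K_σ = K_{σ²}`), i.e. its minimal non-trivial
subfields — "all minimal non-trivial subfields of `F₃`" of the source (mathematically: the cubic
subfields of `ℚ(ζ₁₃)` and of `ℚ(ζ₁₀₃)`, and two cyclic cubic fields of conductor `1339`; not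
formalised). [cite: DokchitserDokchitser2011RankModN, proof of Thm. 2] -/
def cubicField (σ : Gal(F₃/ℚ)) : IntermediateField ℚ F₃ :=
  fixedField (Subgroup.zpowers σ)

/-- An element of `F₃` fixed by `σ` lies in `K_σ` (it is fixed by `⟨σ⟩`). [folklore] -/
theorem mem_cubicField_of_apply_eq {σ : Gal(F₃/ℚ)} {x : F₃} (hx : σ x = x) : x ∈ cubicField σ := by
  rw [cubicField, mem_fixedField_iff]
  intro τ hτ
  have h : Subgroup.zpowers σ ≤ MulAction.stabilizer Gal(F₃/ℚ) x :=
    (Subgroup.zpowers_le (G := Gal(F₃/ℚ))).mpr (MulAction.mem_stabilizer_iff.mpr hx)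
  exact MulAction.mem_stabilizer_iff.mp (h hτ)

/-- **`K_σ` is a cubic field for `σ ≠ 1`**: `σ` has order `3` (`algEquiv_pow_three`), so
`[F₃ : K_σ] = |⟨σ⟩| = 3` (Artin, Mathlib `IntermediateField.finrank_fixedField_eq_card`) and
`[K_σ : ℚ] = 9 / 3 = 3`. [folklore] -/
theorem finrank_cubicField {σ : Gal(F₃/ℚ)} (hσ : σ ≠ 1) : Module.finrank ℚ (cubicField σ) = 3 := by
  haveI : Fact (Nat.Prime 3) := ⟨Nat.prime_three⟩
  have h3 : Module.finrank (cubicField σ) F₃ = 3 := by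
    rw [cubicField, finrank_fixedField_eq_card, Nat.card_zpowers,
      orderOf_eq_prime (algEquiv_pow_three σ) hσ]
  have h := Module.finrank_mul_finrank ℚ (cubicField σ) F₃
  rw [h3, finrank_eq] at h
  omega

end F₃

end DokchitserDokchitser2011

open DokchitserDokchitser2011

/-- **The four cubic `2`-descents** (named fact; the Magma computations behind the `n = 3` case of
the proof of Theorem 2 of Dokchitser–Dokchitser 2011): "2-descent shows that `rk E/F₃ = 1` (e.g.
using Magma, over all minimal non-trivial subfields of `F_n`)" — for `E = 480a1 : y² = x(x+2)(x-3)`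
(`curve480a1`) and every minimal non-trivial subfield of `F₃` (the degree-`9` subfield of
`ℚ(ζ₁₃, ζ₁₀₃)`, `Gal(F₃/ℚ) ≅ C₃ × C₃`), i.e. every fixed field `K_σ = F₃^{⟨σ⟩}` with `σ ≠ 1` — the
four cubic subfields, `F₃.cubicField`, `F₃.finrank_cubicField` — the `2`-descent rank bound
`rk_ℤ E(K_σ) ≤ 1` holds (`WeierstrassCurve.mordellWeilRank = Module.finrank ℤ E(K_σ)`, honest by
the Mordell–Weil theorem). These `2`-descents over cyclic cubic fields (local images at the primes
above `2, 3, 5` and at infinity) are the only non-formalised input of the `n = 3` case: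
`DokchitserDokchitser2011_descent_480a1_F3_of_cubic` derives `rk E(F₃) = 1` from them, and
`DokchitserDokchitser2011_descent_480a1_F3_iff_cubic` shows nothing else is asserted (the bound is
implied back by `rk E(F₃) = 1`). [cite: DokchitserDokchitser2011RankModN, proof of Thm. 2] -/
def DokchitserDokchitser2011_descent_480a1_F3_cubic : Prop :=
  ∀ σ : Gal(F₃/ℚ), σ ≠ 1 → (curve480a1.baseChange (F₃.cubicField σ)).mordellWeilRank ≤ 1

/-- **`rk E(F₃) = 1` from the four cubic `2`-descents** (proof of Theorem 2 of
Dokchitser–Dokchitser 2011, `n = 3`, as printed: "2-descent […] over all minimal non-trivial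
subfields"): `Gal(F₃/ℚ)` has order `9` (`F₃.card_aut`) and exponent `3`
(`F₃.algEquiv_pow_three`); `P = (-1, 2) ∈ E(ℚ)` has infinite order
(`curve480a1.exists_nsmul_ne_zero`); a point of `E(F₃)` fixed by `σ ≠ 1` is defined over the
cubic field `K_σ` (`F₃.mem_cubicField_of_apply_eq`), where `rk E(K_σ) ≤ 1` (the hypothesis); hence
`rk E(F₃) = 1` by the `C₃ × C₃` descent `mordellWeilRank_baseChange_eq_one_of_exponent_three`.
[cite: DokchitserDokchitser2011RankModN, proof of Thm. 2] -/
theorem DokchitserDokchitser2011_descent_480a1_F3_of_cubic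
    (h : DokchitserDokchitser2011_descent_480a1_F3_cubic) :
    (curve480a1.baseChange F₃).mordellWeilRank = 1 :=
  mordellWeilRank_baseChange_eq_one_of_exponent_three (F := F₃) curve480a1 F₃.card_aut
    F₃.algEquiv_pow_three curve480a1.exists_nsmul_ne_zero
    fun σ hσ => ⟨F₃.cubicField σ, inferInstance, inferInstance, inferInstance,
      (F₃.cubicField σ).val, fun x hx => ⟨⟨x, F₃.mem_cubicField_of_apply_eq hx⟩, rfl⟩, h σ hσ⟩

/-- **Converse**: `rk E(F₃) = 1` gives back the cubic bounds, since `rk E(K_σ) ≤ rk E(F₃)` along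
`K_σ ⊂ F₃` (`mordellWeilRank_baseChange_le_of_algHom`). [folklore] -/
theorem DokchitserDokchitser2011_descent_480a1_F3_cubic_of_descent
    (h : (curve480a1.baseChange F₃).mordellWeilRank = 1) :
    DokchitserDokchitser2011_descent_480a1_F3_cubic := fun σ _ =>
  (mordellWeilRank_baseChange_le_of_algHom (F := F₃) curve480a1 (F₃.cubicField σ).val).trans h.le

/-- **`rk E(F₃) = 1` is equivalent to the four cubic `2`-descents**: `rk E(F₃) = 1` iff
`rk E(K_σ) ≤ 1` for all `σ ≠ 1` (given the proved inputs: `C₃ × C₃`, the point of infinite order,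
Mordell–Weil). [cite: DokchitserDokchitser2011RankModN, proof of Thm. 2] -/
theorem DokchitserDokchitser2011_descent_480a1_F3_iff_cubic :
    (curve480a1.baseChange F₃).mordellWeilRank = 1 ↔
      DokchitserDokchitser2011_descent_480a1_F3_cubic :=
  ⟨DokchitserDokchitser2011_descent_480a1_F3_cubic_of_descent,
    DokchitserDokchitser2011_descent_480a1_F3_of_cubic⟩

/-- **The `n = 3` witness of Theorem 2 from the four cubic `2`-descents**: the tree's named fact
`DokchitserDokchitser2011_rank_480a1_F3` (the field `F₃`, its splitting, `rk E(F₃) = 1`) follows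
from `DokchitserDokchitser2011_descent_480a1_F3_cubic` alone (through
`DokchitserDokchitser2011_rank_480a1_F3_of_descent` of the F3 file, all of whose field-theoretic
inputs are theorems). [cite: DokchitserDokchitser2011RankModN, proof of Thm. 2] -/
theorem DokchitserDokchitser2011_rank_480a1_F3_of_cubic
    (h : DokchitserDokchitser2011_descent_480a1_F3_cubic) :
    DokchitserDokchitser2011_rank_480a1_F3 :=
  DokchitserDokchitser2011_rank_480a1_F3_of_descent
    (DokchitserDokchitser2011_descent_480a1_F3_of_cubic h)

/-- **The Mordell–Weil rank modulo `3` is not a sum of local invariants, from the four cubic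
`2`-descents** (the `n = 3` case of Theorem 2 of Dokchitser–Dokchitser 2011, with its Magma
computations over the cubic subfields of `F₃` as the only hypothesis).
[cite: DokchitserDokchitser2011RankModN, Thm. 2 (proof)] -/
theorem not_isSumOfLocalInvariants_rankInvariant_zmod_three_of_cubic
    (h : DokchitserDokchitser2011_descent_480a1_F3_cubic) :
    ¬ IsSumOfLocalInvariants (rankInvariant (ZMod 3)) :=
  not_isSumOfLocalInvariants_rankInvariant_zmod_three_of_descent
    (DokchitserDokchitser2011_descent_480a1_F3_of_cubic h)

end Literature.Barriers.BirchSwinnertonDyer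

end
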